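import Summits.MatrixMultiplication.MatrixMultiplication.Theses.EPRFaces
import Literature.Computability.AlgebraicComplexity.RectangularExponentProofs
import Literature.Computability.AlgebraicComplexity.RectangularExponentAsymptoticRank

/-!
# MatrixMultiplication / EPRFaces — `FaceMaximiser`, stub `stub_convexLift`
(stmt-MatrixMultiplication-10894, line `registered`)

Route `EPRFaces`, crux `FaceMaximiser` (B, rank form:
`∀ k ≥ 1, ∀ β, R(⟨n,n,n^k⟩) = O(n^β) → ω + (k − 1) ≤ β`).  The line reduces B to its `k = 2`
instance via the convexity of `k ↦ ω(1,1,k)` (Lotti–Romani 1983, §1–2).  This file discharges the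
convexity stub: the three-point inequality at the integer nodes `1 < 2 ≤ k`, in RANK FORM and
without `ε`-loss.

Since `2 = (1/(k−1))·k + ((k−2)/(k−1))·1` with weights `a = 1/(k−1)`, `b = (k−2)/(k−1)`
(`a, b ≥ 0`, `a + b = 1` because `k ≥ 2`), an admissible exponent `β` for shape `(1,1,k)` and
`γ` for shape `(1,1,1)` combine (`convexComb_mem_rectAdmissibleExponents_one_one`: Kronecker
submultiplicativity + padding) to the admissible exponent `a·β + b·γ = ((k−2)γ + β)/(k−1)` for
shape `(1,1,2)`.  The rest is re-indexing `⌈n^k⌉ = n^k` (`rectDim_natCast`) and `⌈n^1⌉ = n`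
(`rectDim_one`).
-/

-- the tree's namespace Summit.MatrixMultiplication.MatrixMultiplication.… repeats a component by design
set_option linter.dupNamespace false

namespace Summit.MatrixMultiplication.MatrixMultiplication.Theorems

open Filter Asymptotics
open Literature.Computability.AlgebraicComplexity

/-- Re-indexing: for natural `k`, the rank function of shape `(1, 1, k)` in `rectDim` form,
`n ↦ R(⟨⌈n^1⌉, ⌈n^1⌉, ⌈n^k⌉⟩)`, is literally `n ↦ R(⟨n, n, n^k⟩)`. -/
private theorem rankFun_rectDim_one_one_natCast (k : ℕ) :
    (fun n : ℕ =>
      (tensorRank (matMulTensor ℂ (rectDim n 1) (rectDim n 1) (rectDim n (k : ℝ))) : ℝ)) =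
    fun n : ℕ => (tensorRank (matMulTensor ℂ n n (n ^ k)) : ℝ) :=
  funext fun n => by
    rw [tensorRank_matMulTensor_congr ℂ (rectDim_one n) (rectDim_one n) (rectDim_natCast n k)]

/-- **Convexity lift** (Lotti–Romani three-point inequality at the nodes `1, 2, k`, rank form,
no `ε`-loss; stub `stub_convexLift` of crux `FaceMaximiser`, stmt-MatrixMultiplication-10894).
For `k ≥ 2`: if `R(⟨n,n,n^k⟩) = O(n^β)` and `R(⟨n,n,n⟩) = O(n^γ)` then
`R(⟨n,n,n²⟩) = O(n^{((k−2)γ+β)/(k−1)})` — since `2 = (1/(k−1))·k + ((k−2)/(k−1))·1`, the convex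
combination `(1/(k−1))·β + ((k−2)/(k−1))·γ` of the admissible exponents is admissible for shape
`(1,1,2)` (`convexComb_mem_rectAdmissibleExponents_one_one`, after the `rectDim_natCast` /
`rectDim_one` re-indexing). [LottiRomani1983 §1, p. 173] -/
theorem stub_convexLift :
    ∀ k : ℕ, 2 ≤ k → ∀ β γ : ℝ,
      ((fun n : ℕ => (tensorRank (matMulTensor ℂ n n (n ^ k)) : ℝ)) =O[atTop]
        fun n : ℕ => (n : ℝ) ^ β) →
      ((fun n : ℕ => (tensorRank (matMulTensor ℂ n n n) : ℝ)) =O[atTop]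
        fun n : ℕ => (n : ℝ) ^ γ) →
      ((fun n : ℕ => (tensorRank (matMulTensor ℂ n n (n ^ 2)) : ℝ)) =O[atTop]
        fun n : ℕ => (n : ℝ) ^ ((((k : ℝ) - 2) * γ + β) / ((k : ℝ) - 1))) := by
  intro k hk β γ hβ hγ
  have hk' : (2 : ℝ) ≤ (k : ℝ) := by exact_mod_cast hk
  have hpos : (0 : ℝ) < (k : ℝ) - 1 := by linarith
  have hne : (k : ℝ) - 1 ≠ 0 := hpos.ne'
  -- the two hypotheses as memberships in the rectangular admissible exponents
  have hβmem : β ∈ rectAdmissibleExponents ℂ 1 1 (k : ℝ) := by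
    show (fun n : ℕ =>
        (tensorRank (matMulTensor ℂ (rectDim n 1) (rectDim n 1) (rectDim n (k : ℝ))) : ℝ))
      =O[atTop] fun n : ℕ => (n : ℝ) ^ β
    rw [rankFun_rectDim_one_one_natCast k]
    exact hβ
  have hγmem : γ ∈ rectAdmissibleExponents ℂ 1 1 1 := by
    rw [rectAdmissibleExponents_one_one_one]
    exact hγ
  -- weights `a = 1/(k-1)`, `b = (k-2)/(k-1)`
  have ha : (0 : ℝ) ≤ 1 / ((k : ℝ) - 1) := div_nonneg zero_le_one hpos.le
  have hb : (0 : ℝ) ≤ ((k : ℝ) - 2) / ((k : ℝ) - 1) := div_nonneg (by linarith) hpos.le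
  have hab : 1 / ((k : ℝ) - 1) + ((k : ℝ) - 2) / ((k : ℝ) - 1) = 1 := by
    rw [← add_div, div_eq_one_iff_eq hne]
    ring
  have h := convexComb_mem_rectAdmissibleExponents_one_one ℂ (Nat.cast_nonneg k) zero_le_one
    ha hb hab hβmem hγmem
  -- the combined shape is `(1,1,2)` and the combined exponent is `((k-2)γ+β)/(k-1)`
  have hx : 1 / ((k : ℝ) - 1) * (k : ℝ) + ((k : ℝ) - 2) / ((k : ℝ) - 1) * 1 = ((2 : ℕ) : ℝ) := by
    field_simp
    push_cast
    ring
  have he : 1 / ((k : ℝ) - 1) * β + ((k : ℝ) - 2) / ((k : ℝ) - 1) * γ =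
      (((k : ℝ) - 2) * γ + β) / ((k : ℝ) - 1) := by
    field_simp
    ring
  rw [hx, he] at h
  have h' : (fun n : ℕ =>
        (tensorRank (matMulTensor ℂ (rectDim n 1) (rectDim n 1) (rectDim n ((2 : ℕ) : ℝ))) : ℝ))
      =O[atTop] fun n : ℕ => (n : ℝ) ^ ((((k : ℝ) - 2) * γ + β) / ((k : ℝ) - 1)) := h
  rw [rankFun_rectDim_one_one_natCast 2] at h'
  exact h'

end Summit.MatrixMultiplication.MatrixMultiplication.Theorems
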